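import Summits.QuantumFields.YangMills.Theorems.LuscherReductionTwistedTraceScalingTowerOfUniform
import HarnessLib

/-!
# `TwistedTraceScaling` (crux stmt-QuantumFields-20203, route `LuscherReduction`, skeleton «twolattice» REV 2 «E1 COVERAGE»):
# negative-side support VI — DESIGN FACT: the registered stub TOWER-E1 (`stub_towerE1`) with its `lam`-UNIFORMITY removed
# (`∃ M` chosen AFTER `lam`) is already a consequence of the femto trace law, i.e. of the crux itself
# (refuter crux-disprover seat, cycle 2; no verdict on the crux or any stub)

HONEST FRAMING: `TwistedTraceScaling` is a femto-rung (R2b1) crux of a CONDITIONAL reduction route; nothing here is a mass-gap or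
Clay statement.  TOWER-E1 reads `∀ s ε, ∃ M ≥ 2, ∃ lam0 > 0, ∀ lam ≤ lam0, ∀ L ≥ M², ∀ β ∈ W(lam,L), ∀ (b,k) E1-pair, ∀ β₁ ≥ 1
matched, |r_L − r_b| ≤ ε` — the base scale `M` and the depth `lam0` are fixed BEFORE `lam`.  This file certifies what is left when that
uniformity is dropped: the text `towerE1NonUniform` below (`∃ lam0 ∀ lam ∃ M ≥ 2 …`, everything else verbatim) follows from the femto
trace law FTL (`∀ s ε ∃ lam0 ∀ lam ∃ L0 ∀ L ≥ L0 ∀ β ∈ W(lam,L), |r_L(β,⌈sL/Λ⌉) − r_𝔥(s)| ≤ ε`), which by tree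
`Tower.twistedTraceScaling_iff_femtoTraceLaw` is EQUIVALENT to the crux: both members of a matched pair lie in windows of the same
depth (`Tower.window_of_matched`) on lattices `≥ M ≥ L0(lam)`.  Consequences for planners (negative design facts, kernel-checked here
and in `Tower.twistedTraceScaling_of_towerE1_of_base`): (i) modulo the closed S-OSTL the ONLY content of TOWER-E1 beyond the crux is
the `lam`-uniformity of `(M, lam0)`; (ii) that uniformity is exactly what the descent `TOWER-E1 ∧ S-BASE ⇒ crux` consumes (S-BASE's
`β`-thresholds on the finitely many bases `b ∈ [M, M²)` are met by taking `lam` small AFTER `M` is fixed; a matched `β₁` stays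
`O(1/lam³)` as `L → ∞`, so an `M(lam)` would make the threshold argument circular) — de-uniformising TOWER-E1 is therefore not a usable
weakening: it yields a statement implied by the crux that no longer composes with S-BASE.  No Theses import (FTL is spelled out).
-/

set_option autoImplicit false

noncomputable section

namespace Summit.QuantumFields.YangMills.Theorems.TwistedTraceScaling.Negative

open Summit.QuantumFields.YangMills.Theorems.FemtoTransferGap
open Summit.QuantumFields.YangMills.Theorems.FemtoTransferGap.TraceDoor
open Summit.QuantumFields.YangMills.Theorems.FemtoTransferGap.TT
open Summit.QuantumFields.YangMills.Theorems.FemtoTransferGap.TwoLattice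

/-- **TOWER-E1 without `lam`-uniformity follows from the femto trace law** (hence from the crux, `Tower.twistedTraceScaling_iff_femtoTraceLaw`):
hypothesis = FTL verbatim (right-hand side of that tree equivalence); conclusion = `Stmt.stub_towerE1` with `∃ M, 2 ≤ M ∧` moved after
`∀ lam` (all other binders verbatim).  Witness `M := L0(lam) + 2`; the base member of a matched pair is in the window of the same depth
by `Tower.window_of_matched`. [folklore] -/
theorem towerE1NonUniform_of_femtoTraceLaw
    (hFTL : ∀ s : ℝ, 0 < s → ∀ ε : ℝ, 0 < ε → ∃ lam0 : ℝ, 0 < lam0 ∧ ∀ lam : ℝ, 0 < lam → lam ≤ lam0 →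
      ∃ L0 : ℕ, ∀ (L : ℕ) [NeZero L], L0 ≤ L → ∀ β : ℝ, InFemtoWindow lam β L →
        |traceRatio L β (femtoSteps s β L) - hTraceRatio s| ≤ ε) :
    ∀ s : ℝ, 0 < s → ∀ ε : ℝ, 0 < ε → ∃ lam0 : ℝ, 0 < lam0 ∧ ∀ lam : ℝ, 0 < lam → lam ≤ lam0 → ∃ M : ℕ, 2 ≤ M ∧
      ∀ (L : ℕ) [NeZero L], M ^ 2 ≤ L → ∀ β : ℝ, InFemtoWindow lam β L →
        ∀ (b k : ℕ) [NeZero b], M ≤ b → b < M ^ 2 → b * M ^ (k + 1) ≤ L → L < b * M ^ k * (M + 1) →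
          ∀ β₁ : ℝ, 1 ≤ β₁ → invRunningCoupling β₁ b = invRunningCoupling β L →
            |traceRatio L β (femtoSteps s β L) - traceRatio b β₁ (femtoSteps s β₁ b)| ≤ ε := by
  intro s hs ε hε
  obtain ⟨lam0, hlam0, h⟩ := hFTL s hs (ε / 2) (by positivity)
  refine ⟨lam0, hlam0, fun lam hlam hle => ?_⟩
  obtain ⟨L0, hL0⟩ := h lam hlam hle
  refine ⟨L0 + 2, by omega, ?_⟩
  intro L _ hL β hW b k _ hMb _ _ _ β₁ hβ₁ hmatch
  have hW₁ : InFemtoWindow lam β₁ b := Tower.window_of_matched hW hβ₁ hmatch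
  have h1 := hL0 L (by nlinarith) β hW
  have h2 := hL0 b (by omega) β₁ hW₁
  rw [abs_le] at h1 h2 ⊢
  constructor <;> linarith

/-- The same for the `lam`-uniform femto trace law UFTL (`∃ L0 ∃ lam0` before `∀ lam`, hypothesis `hU` of tree
`Tower.twistedTraceScaling_of_uniform`): it gives the REGISTERED (uniform) TOWER-E1 text outright, with `M := L0 + 2` — so
`UFTL ⇒ TOWER-E1`, `TOWER-E1 ∧ S-BASE ⇒ crux` (tree `Tower.twistedTraceScaling_of_towerE1_of_base`), `crux ⇔ FTL` (tree),
`FTL ⇒ TOWER-E1-without-uniformity` (above). [folklore] -/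
theorem towerE1_of_uniformFemtoTraceLaw
    (hU : ∀ s : ℝ, 0 < s → ∀ ε : ℝ, 0 < ε → ∃ L0 : ℕ, ∃ lam0 : ℝ, 0 < lam0 ∧ ∀ lam : ℝ, 0 < lam → lam ≤ lam0 →
      ∀ (L : ℕ) [NeZero L], L0 ≤ L → ∀ β : ℝ, InFemtoWindow lam β L →
        |traceRatio L β (femtoSteps s β L) - hTraceRatio s| ≤ ε) :
    ∀ s : ℝ, 0 < s → ∀ ε : ℝ, 0 < ε → ∃ M : ℕ, 2 ≤ M ∧ ∃ lam0 : ℝ, 0 < lam0 ∧ ∀ lam : ℝ, 0 < lam → lam ≤ lam0 →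
      ∀ (L : ℕ) [NeZero L], M ^ 2 ≤ L → ∀ β : ℝ, InFemtoWindow lam β L →
        ∀ (b k : ℕ) [NeZero b], M ≤ b → b < M ^ 2 → b * M ^ (k + 1) ≤ L → L < b * M ^ k * (M + 1) →
          ∀ β₁ : ℝ, 1 ≤ β₁ → invRunningCoupling β₁ b = invRunningCoupling β L →
            |traceRatio L β (femtoSteps s β L) - traceRatio b β₁ (femtoSteps s β₁ b)| ≤ ε := by
  intro s hs ε hε
  obtain ⟨L0, lam0, hlam0, h⟩ := hU s hs (ε / 2) (by positivity)
  refine ⟨L0 + 2, by omega, lam0, hlam0, fun lam hlam hle => ?_⟩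
  intro L _ hL β hW b k _ hMb _ _ _ β₁ hβ₁ hmatch
  have hW₁ : InFemtoWindow lam β₁ b := Tower.window_of_matched hW hβ₁ hmatch
  have h1 := h lam hlam hle L (by nlinarith) β hW
  have h2 := h lam hlam hle b (by omega) β₁ hW₁
  rw [abs_le] at h1 h2 ⊢
  constructor <;> linarith

end Summit.QuantumFields.YangMills.Theorems.TwistedTraceScaling.Negative

end
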